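import Literature.NumberTheory.PAdicHodge.CompletedAlgClosurePadicComplexOfEmbedding
import Literature.NumberTheory.NumberFields.AdicCompletionIntegersPadicIntOfDegreeOne
import Literature.NumberTheory.NumberFields.AdicCompletionResidueCardUniformizerOfPadicIntEquiv
import Literature.NumberTheory.GaloisRepresentations.LubinTateComparisonTraceTransportTwo
import Literature.NumberTheory.EllipticCurves.PAdicTwoVariableTransformCharacter
import HarnessLib

/-!
# The local analytic seam at a place of DEGREE ONE above `2`: the reading `θ : ℂ_{K_v} → ℂ₂` with `hθ1`, `hΘe`
# (for `e₂ := padicIntEquivOfDegreeOne`), the field identification `K_v ≅ ℚ₂`, and `hq`, `h2` — all DISCHARGED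

Cell `bsd-print-cf2` (HOME `run/shared/lean/pub/bsd-print-cf2/`), width seat `bsd-line-cf2-p1-w7` g11; `--supports` the banked S3a
item stmt-BirchSwinnertonDyer-24721 (helper, Theses-free).  THEOREMS ONLY; no definition, no named fact, no `sorry`.

WHAT.  The one-`𝔓` measure theorems of de Shalit II.4.12 for the elliptic units
(`EllipticUnitsLocal.exists_groupDistribution_twisting_eq_induce_ellipticUnitsLocal`, `…_of_principal`; cell files
`Theorems/PrintCf2RubinValueTwoEllipticUnitsLocalMeasure(Principal).lean`, cf2c-w4 g10) carry a group (i) of LOCAL ANALYTIC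
hypotheses at the completion `K_v`: `hq : #𝓀(K_v) = 2`, `h2 : 2` a uniformiser of `K_v`, a reading `θ : ℂ_{K_v} →+* ℂ_[2]` with
`hθ1 : ‖θ z‖ ≤ 1` on `𝒪_{ℂ_{K_v}}` and `hΘe : θ ∘ (𝒪[K_v] → 𝐃 → 𝒪_{ℂ_{K_v}}) = padicIntCast ∘ e₂ ∘ (𝒪[K_v] ≅ 𝒪_v)` for a ring
isomorphism `e₂ : 𝒪_v ≃+* ℤ₂` (besides `σ₀`, `ε`, `j`, `ψ`, which the tree supplies for every local field:
`exists_isAbsArithFrob_holds`, `LubinTate.exists_unit_galAut_eq_mul`, `unitBallToUnrCoeff` with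
`unitBallToUnrCoeff_comp_algebraMap` / `algebraMap_comp_unitBallToUnrCoeff`, `exists_cellMap_of_character`).  In de Shalit's standing
situation (II.1.1, I.3.3: `p` split in the imaginary quadratic field `K`, `𝔭 = v` of DEGREE ONE, `𝒪_𝔭 = ℤ_p`, `K_𝔭 = ℚ_p`) THIS file
discharges (i) for `e₂ := padicIntEquivOfDegreeOne K 2 v he hf` (-w3 g19), at every prime `p` and then verbatim at `p = 2`:

* §1 `exists_ringEquiv_padic_of_degree_one` — the FIELD identification `φ : K_v ≃+* ℚ_[p]` (tree `adicCompletionEquivOfDegreeOne`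
  composed with Mathlib's `Padic.adicCompletionEquiv`), continuous both ways, the identity on `ℚ`, and EQUAL TO `padicIntEquivOfDegreeOne`
  on `𝒪_v`; `valuation_natCast_lt_one_of_degree_one` — `|p|_v < 1`;
* §2 ★ `exists_reading_of_degree_one` — **there are `φ : K_v →+* ℚ_[p]` as in §1 and `θ : ℂ_{K_v} →+* ℂ_[p]` with `hθ1`, `hΘe` (for
  `e₂ := padicIntEquivOfDegreeOne`), `θ ∘ algebraMap K_v = coe ∘ φ`, `θ` bijective and continuous, strict on the open unit ball** —
  `CompletedAlgClosure.exists_ringHom_padicComplex_of_continuous` (this seat, `Literature/…/CompletedAlgClosurePadicComplexOfEmbedding`)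
  along `φ`, and `coe_algebraMap_intToUnrCoeff` for the `𝐃`-leg of `hΘe`;
* §3 at `p = 2` VERBATIM for the consumers: `residueFieldCard_eq_two_of_degree_one` (`hq`), `isUniformizer_two_of_degree_one` (`h2`) — both
  cf2c-w4 g10's `…_of_padicIntEquiv` lemmas at `e := padicIntEquivOfDegreeOne` —, and ★★ `exists_theta_two_of_degree_one` (`θ`, `hθ1`, `hΘe`
  in the letter of `exists_groupDistribution_twisting_eq_induce_ellipticUnitsLocal(_of_principal)` with `e₂ := padicIntEquivOfDegreeOne K 2 v he hf`).

HONEST FRAMING: plumbing between the tree's local models (`K_v`, `ℂ_{K_v}`) and Mathlib's (`ℚ_[2]`, `ℤ_[2]`, `ℂ_[2]`); nothing here closes a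
crux; no summit statement is proved by this seat; BSD is not proved by any of this.

## References
* [deShalit1987] E. de Shalit, *Iwasawa theory of elliptic curves with complex multiplication* (1987), I.3.3 (p. 17), II.1.1 (p. 32)
  (`𝒪_𝔭 = ℤ_p` at a split prime), II.4.12 (p. 66–69).
* [FrohlichTaylor1990] A. Fröhlich, M. J. Taylor, *Algebraic number theory* (1993), Ch. III §1 (1.14)(a) (`[K_w : F_v] = e f`).
-/

-- the summit namespace `Summit.BirchSwinnertonDyer.BirchSwinnertonDyer` repeats the problem name by design (D-0017)
set_option linter.dupNamespace false
set_option autoImplicit false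

noncomputable section

open scoped NumberField
open Field IsDedekindDomain ValuativeRel
open Literature.NumberTheory.NumberFields Literature.NumberTheory.Automorphic
open Literature.NumberTheory.GaloisRepresentations Literature.NumberTheory.GaloisRepresentations.IsNonarchimedeanLocalField
  Literature.NumberTheory.GaloisRepresentations.LubinTate Literature.NumberTheory.PAdicHodge
open Literature.NumberTheory.EllipticCurves

namespace Summit.BirchSwinnertonDyer.BirchSwinnertonDyer.Theorems.PrintCf2.EllipticUnitsLocal.Seam

/-! ## §1. The field identification `K_v ≅ ℚ_p` at a place of degree one, compatible with `padicIntEquivOfDegreeOne` -/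

section AnyPrime

variable (K : Type) [Field K] [NumberField K] (p : ℕ) [hp : Fact p.Prime] (v : HeightOneSpectrum (𝓞 K))
  [v.asIdeal.LiesOver (ratPlace p).asIdeal]
  (he : v.asIdeal.ramificationIdx (𝓞 ℚ) = 1) (hf : v.asIdeal.inertiaDeg (𝓞 ℚ) = 1)

/-- **`K_v ≅ ℚ_p` at a place of degree one, as fields, compatibly with `𝒪_v ≅ ℤ_p`.**  For a finite place `v` of the number field `K`
above `p` with `e(v|p) = f(v|p) = 1` there is a ring isomorphism `φ : K_v ≃+* ℚ_[p]`, continuous with continuous inverse, which is the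
identity on `ℚ` and restricts on `𝒪_v` to the tree's `padicIntEquivOfDegreeOne K p v he hf : 𝒪_v ≃+* ℤ_[p]` (both are the tree's
`adicCompletionEquivOfDegreeOne ℚ K (p) v` composed with Mathlib's `ℚ_[p] ≅ ℚ_{(p)}`). [cite: FrohlichTaylor1990, Ch. III §1 (1.14)(a)]
[cite: deShalit1987, II.1.1 (p. 32)] -/
theorem exists_ringEquiv_padic_of_degree_one :
    ∃ φ : v.adicCompletion K ≃+* ℚ_[p], Continuous φ ∧ Continuous φ.symm ∧
      (∀ x : ℚ, φ (((algebraMap ℚ K x : K) : v.adicCompletion K)) = (x : ℚ_[p])) ∧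
      ∀ x : v.adicCompletionIntegers K,
        φ (x : v.adicCompletion K) = ((padicIntEquivOfDegreeOne K p v he hf x : ℤ_[p]) : ℚ_[p]) := by
  refine ⟨(adicCompletionEquivOfDegreeOne ℚ K (ratPlace p) v he hf).symm.trans
      (Padic.adicCompletionEquiv (𝓞 ℚ) ⟨p, hp.out⟩).symm.toAlgEquiv.toRingEquiv, ?_, ?_, fun x => ?_, fun x => ?_⟩
  · exact (Padic.adicCompletionEquiv (𝓞 ℚ) ⟨p, hp.out⟩).symm.continuous.comp
      (continuous_adicCompletionEquivOfDegreeOne_symm ℚ K (ratPlace p) v he hf)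
  · exact (continuous_adicCompletionEquivOfDegreeOne ℚ K (ratPlace p) v he hf).comp
      (Padic.adicCompletionEquiv (𝓞 ℚ) ⟨p, hp.out⟩).continuous
  · -- the identity on `ℚ`
    have h1 : (adicCompletionEquivOfDegreeOne ℚ K (ratPlace p) v he hf).symm (((algebraMap ℚ K x : K) : v.adicCompletion K)) =
        algebraMap ℚ ((ratPlace p).adicCompletion ℚ) x := by
      apply (adicCompletionEquivOfDegreeOne ℚ K (ratPlace p) v he hf).injective
      rw [RingEquiv.apply_symm_apply]
      exact (adicCompletionEquivOfDegreeOne_coe ℚ K (ratPlace p) v he hf x).symm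
    have h2 : (Padic.adicCompletionEquiv (𝓞 ℚ) ⟨p, hp.out⟩).symm.toAlgEquiv.toRingEquiv
        (algebraMap ℚ ((ratPlace p).adicCompletion ℚ) x) = algebraMap ℚ ℚ_[p] x :=
      (Padic.adicCompletionEquiv (𝓞 ℚ) ⟨p, hp.out⟩).symm.toAlgEquiv.commutes x
    rw [RingEquiv.trans_apply, h1]
    exact h2
  · -- compatibility with `padicIntEquivOfDegreeOne` on `𝒪_v`
    have key : ((Padic.adicCompletionEquiv (𝓞 ℚ) ⟨p, hp.out⟩).symm
          ((adicCompletionEquivOfDegreeOne ℚ K (ratPlace p) v he hf).symm (x : v.adicCompletion K)) : ℚ_[p]) =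
        (((PadicInt.adicCompletionIntegersEquiv (R := 𝓞 ℚ) ⟨p, hp.out⟩).symm
          (adicCompletionIntegersEquivOfDegreeOne K (ratPlace p) v he hf x) : ℤ_[p]) : ℚ_[p]) := by
      rw [PadicInt.coe_adicCompletionIntegersEquiv_symm_apply, coe_adicCompletionIntegersEquivOfDegreeOne_apply]
    rw [RingEquiv.trans_apply]
    exact key

include he hf in
/-- **`|p|_v < 1` at a place of degree one above `p`** (`p` is a uniformiser of `K_v`: cf2c-w4's
`isUniformizer_natCast_adicCompletion_of_padicIntEquiv` at `e := padicIntEquivOfDegreeOne`). [cite: deShalit1987, I.3.3 (p. 17)] -/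
theorem valuation_natCast_lt_one_of_degree_one : valuation (v.adicCompletion K) (p : v.adicCompletion K) < 1 := by
  have h := (isUniformizer_natCast_adicCompletion_of_padicIntEquiv v (padicIntEquivOfDegreeOne K p v he hf)).val_lt_one
  exact_mod_cast h

/-! ## §2. The reading `θ : ℂ_{K_v} → ℂ_[p]` with `hθ1`, `hΘe` for `e₂ := padicIntEquivOfDegreeOne` -/

/-- ★ **The reading `θ : ℂ_{K_v} →+* ℂ_[p]` at a place of degree one, with `hθ1` and `hΘe`.**  For `v` of degree one above `p` there are
a continuous bijective ring map `φ : K_v →+* ℚ_[p]` — the identity on `ℚ`, equal to `padicIntEquivOfDegreeOne K p v he hf` on `𝒪_v` — and a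
continuous bijective ring map `θ : ℂ_{K_v} →+* ℂ_[p]` with: `‖θ z‖ ≤ 1` on the closed unit ball `𝒪_{ℂ_{K_v}}` (`hθ1`), `‖θ z‖ < 1` on the
open unit ball, `θ ∘ algebraMap K_v = coe ∘ φ`, and the compatibility `hΘe` of the measure-side files: `θ` of `a ∈ 𝒪[K_v]` read through
`𝒪[K_v] → 𝐃 = 𝒪̂_{K_v^nr} → 𝒪_{ℂ_{K_v}}` is `padicIntCast ℂ_[p] (e₂ a)` for `e₂ = padicIntEquivOfDegreeOne ∘ (𝒪[K_v] ≅ 𝒪_v)`.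
[cite: deShalit1987, I.3.3 (p. 17), II.4.12 (p. 66–69)] [cite: FrohlichTaylor1990, Ch. III §1 (1.14)(a)] -/
theorem exists_reading_of_degree_one :
    ∃ (φ : v.adicCompletion K →+* ℚ_[p]) (θ : CompletedAlgClosure (v.adicCompletion K) →+* ℂ_[p]),
      Continuous φ ∧ Function.Bijective φ ∧
      (∀ x : ℚ, φ (((algebraMap ℚ K x : K) : v.adicCompletion K)) = (x : ℚ_[p])) ∧
      (∀ x : v.adicCompletionIntegers K,
        φ (x : v.adicCompletion K) = ((padicIntEquivOfDegreeOne K p v he hf x : ℤ_[p]) : ℚ_[p])) ∧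
      Continuous θ ∧ Function.Bijective θ ∧
      (∀ z : CBall (v.adicCompletion K), ‖θ (z : CompletedAlgClosure (v.adicCompletion K))‖ ≤ 1) ∧
      (∀ z : CompletedAlgClosure (v.adicCompletion K), ‖z‖ < 1 → ‖θ z‖ < 1) ∧
      (∀ a : v.adicCompletion K, θ (algebraMap (v.adicCompletion K) (CompletedAlgClosure (v.adicCompletion K)) a) =
        ((φ a : ℚ_[p]) : ℂ_[p])) ∧
      (∀ a : 𝒪[v.adicCompletion K], (θ.comp ((CBall (v.adicCompletion K)).subtype.comp
          (algebraMap (UnrCoeff (v.adicCompletion K)) (CBall (v.adicCompletion K))))) (intToUnrCoeff (v.adicCompletion K) a) =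
        padicIntCast ℂ_[p] ((((padicIntEquivOfDegreeOne K p v he hf : v.adicCompletionIntegers K ≃+* ℤ_[p]) :
            v.adicCompletionIntegers K →+* ℤ_[p]).comp (integerEquivAdicCompletionIntegers v).toRingHom) a)) := by
  haveI : CharZero (v.adicCompletion K) :=
    charZero_of_injective_algebraMap (algebraMap K (v.adicCompletion K)).injective
  obtain ⟨φ, hφc, -, hφQ, hφint⟩ := exists_ringEquiv_padic_of_degree_one K p v he hf
  obtain ⟨θ, hθ1, hθlt, hθφ, hθbij, hθc⟩ :=
    CompletedAlgClosure.exists_ringHom_padicComplex_of_continuous (F := v.adicCompletion K) p φ.toRingHom hφc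
      (valuation_natCast_lt_one_of_degree_one K p v he hf)
  refine ⟨φ.toRingHom, θ, hφc, φ.bijective, hφQ, hφint, hθc, hθbij, fun z => hθ1 z z.2, hθlt, hθφ, fun a => ?_⟩
  have ha : ((integerEquivAdicCompletionIntegers v a : v.adicCompletionIntegers K) : v.adicCompletion K) =
      (a : v.adicCompletion K) := rfl
  have hb : (((((padicIntEquivOfDegreeOne K p v he hf : v.adicCompletionIntegers K ≃+* ℤ_[p]) :
        v.adicCompletionIntegers K →+* ℤ_[p]).comp (integerEquivAdicCompletionIntegers v).toRingHom) a : ℤ_[p]) : ℚ_[p]) =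
      φ (a : v.adicCompletion K) := by
    rw [← ha, hφint]
    rfl
  rw [RingHom.comp_apply, RingHom.comp_apply, Subring.subtype_apply, coe_algebraMap_intToUnrCoeff, hθφ, padicIntCast_apply, hb]
  rfl

end AnyPrime

/-! ## §3. `p = 2` VERBATIM for `exists_groupDistribution_twisting_eq_induce_ellipticUnitsLocal(_of_principal)` -/

section Two

variable (K : Type) [Field K] [NumberField K] (v : HeightOneSpectrum (𝓞 K)) [v.asIdeal.LiesOver (ratPlace 2).asIdeal]
  (he : v.asIdeal.ramificationIdx (𝓞 ℚ) = 1) (hf : v.asIdeal.inertiaDeg (𝓞 ℚ) = 1)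

include he hf in
/-- `hq` at a place of degree one above `2`: `#𝓀(K_v) = 2` (cf2c-w4's lemma at `e := padicIntEquivOfDegreeOne`).
[cite: deShalit1987, II.1.1 (p. 32)] -/
theorem residueFieldCard_eq_two_of_degree_one : residueFieldCard (v.adicCompletion K) = 2 :=
  residueFieldCard_adicCompletion_of_padicIntEquiv v (padicIntEquivOfDegreeOne K 2 v he hf)

include he hf in
/-- `h2` at a place of degree one above `2`: `2` is a uniformiser of `K_v` (cf2c-w4's lemma at `e := padicIntEquivOfDegreeOne`).
[cite: deShalit1987, I.3.3 (p. 17)] -/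
theorem isUniformizer_two_of_degree_one :
    (valuation (v.adicCompletion K)).IsUniformizer ((((2 : ℕ) : 𝒪[v.adicCompletion K]) : v.adicCompletion K)) :=
  isUniformizer_natCast_adicCompletion_of_padicIntEquiv v (padicIntEquivOfDegreeOne K 2 v he hf)

/-- ★★ **The reading `θ : ℂ_{K_v} →+* ℂ_[2]` with `hθ1` and `hΘe` for `e₂ := padicIntEquivOfDegreeOne K 2 v he hf`, VERBATIM** the
hypotheses `θ`, `hθ1`, `hΘe` (with that `e₂`) of `exists_groupDistribution_twisting_eq_induce_ellipticUnitsLocal(_of_principal)` at a place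
`v` of degree one above `2` — de Shalit's `K_𝔭 = ℚ_p`, `𝒪_𝔭 = ℤ_p`; with, in addition, continuity and bijectivity of `θ` and the field map
`φ : K_v →+* ℚ_[2]` it extends (`θ ∘ algebraMap K_v = coe ∘ φ`, `φ = e₂` on `𝒪_v`, `φ` the identity on `ℚ`).
[cite: deShalit1987, I.3.3 (p. 17), II.1.1 (p. 32), II.4.12 (p. 66–69)] -/
theorem exists_theta_two_of_degree_one :
    ∃ (φ : v.adicCompletion K →+* ℚ_[2]) (θ : CompletedAlgClosure (v.adicCompletion K) →+* ℂ_[2]),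
      Continuous φ ∧ Function.Bijective φ ∧
      (∀ x : ℚ, φ (((algebraMap ℚ K x : K) : v.adicCompletion K)) = (x : ℚ_[2])) ∧
      (∀ x : v.adicCompletionIntegers K,
        φ (x : v.adicCompletion K) = ((padicIntEquivOfDegreeOne K 2 v he hf x : ℤ_[2]) : ℚ_[2])) ∧
      Continuous θ ∧ Function.Bijective θ ∧
      (∀ a : v.adicCompletion K, θ (algebraMap (v.adicCompletion K) (CompletedAlgClosure (v.adicCompletion K)) a) =
        ((φ a : ℚ_[2]) : ℂ_[2])) ∧
      (∀ z : CBall (v.adicCompletion K), ‖θ (z : CompletedAlgClosure (v.adicCompletion K))‖ ≤ 1) ∧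
      (∀ a : 𝒪[v.adicCompletion K], (θ.comp ((CBall (v.adicCompletion K)).subtype.comp
          (algebraMap (UnrCoeff (v.adicCompletion K)) (CBall (v.adicCompletion K))))) (intToUnrCoeff (v.adicCompletion K) a) =
        padicIntCast ℂ_[2] ((((padicIntEquivOfDegreeOne K 2 v he hf : v.adicCompletionIntegers K ≃+* ℤ_[2]) :
            v.adicCompletionIntegers K →+* ℤ_[2]).comp (integerEquivAdicCompletionIntegers v).toRingHom) a)) := by
  obtain ⟨φ, θ, hφc, hφb, hφQ, hφint, hθc, hθb, hθ1, -, hθφ, hΘe⟩ := exists_reading_of_degree_one K 2 v he hf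
  exact ⟨φ, θ, hφc, hφb, hφQ, hφint, hθc, hθb, hθφ, hθ1, hΘe⟩

end Two

/-! ## §4. Over the NAMED field identification `padicEquivOfDegreeOne K p v he hf : K_v ≃+* ℚ_[p]` (-w3 g19, §5 of
`Literature/…/AdicCompletionIntegersPadicIntOfDegreeOne.lean`): `θ` as a ring ISOMORPHISM `ℂ_{K_v} ≃+* ℂ_[p]`, with the
algebraic elements, the norm law, both unit balls, `hθ1`, `hΘe` — the currency for consumers that must COMPUTE with `φ` and `θ`
(values at algebraic numbers; appended by the same seat after §1–§3 landed as p750062) -/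

section Named

variable (K : Type) [Field K] [NumberField K] (p : ℕ) [hp : Fact p.Prime] (v : HeightOneSpectrum (𝓞 K))
  [v.asIdeal.LiesOver (ratPlace p).asIdeal]
  (he : v.asIdeal.ramificationIdx (𝓞 ℚ) = 1) (hf : v.asIdeal.inertiaDeg (𝓞 ℚ) = 1)

/-- ★★ **`θ : ℂ_{K_v} ≃+* ℂ_[p]` over the NAMED `φ = padicEquivOfDegreeOne K p v he hf`.**  At a place `v` of degree one above `p`
there is a ring isomorphism `θ : ℂ_{K_v} ≃+* ℂ_[p]` such that, for the `K_v`-algebra structure `φ` on `ℚ_[p]` and the tree's chosen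
`K_v`-embedding `ι = absClosureEmbedding K_v ℚ_[p] : K̄_v → ℚ̄_p`: (i) `θ ∘ (K̄_v → ℂ_{K_v}) = (ℚ̄_p ⊆ ℂ_[p]) ∘ ι` (algebraic elements);
(ii) `θ (algebraMap K_v ℂ_{K_v} a) = φ a`; (iii) `‖θ z‖ = ‖z‖ ^ t` for a real `t > 0`; (iv)–(vi) closed / open unit balls and the unit
sphere correspond; (vii) `θ`, `θ⁻¹` continuous; and, for the ring map `θ.toRingHom`, (viii) `hθ1` and (ix) `hΘe` with
`e₂ := padicIntEquivOfDegreeOne K p v he hf` in the letter of the measure-side files.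
[cite: deShalit1987, I.3.3 (p. 17), II.1.1 (p. 32), II.4.12 (p. 66–69)] [cite: FrohlichTaylor1990, Ch. III §1 (1.14)(a)] -/
theorem exists_ringEquiv_theta_padicEquivOfDegreeOne :
    letI : Algebra (v.adicCompletion K) ℚ_[p] := (padicEquivOfDegreeOne K p v he hf).toRingHom.toAlgebra
    ∃ θ : CompletedAlgClosure (v.adicCompletion K) ≃+* ℂ_[p],
      (∀ y : AlgebraicClosure (v.adicCompletion K), θ (algClosureToC (v.adicCompletion K) y) =
        ((absClosureEmbedding (v.adicCompletion K) ℚ_[p] y : PadicAlgCl p) : ℂ_[p])) ∧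
      (∀ a : v.adicCompletion K, θ (algebraMap (v.adicCompletion K) (CompletedAlgClosure (v.adicCompletion K)) a) =
        ((padicEquivOfDegreeOne K p v he hf a : ℚ_[p]) : ℂ_[p])) ∧
      (∃ t : ℝ, 0 < t ∧ ∀ z : CompletedAlgClosure (v.adicCompletion K), ‖θ z‖ = ‖z‖ ^ t) ∧
      (∀ z : CompletedAlgClosure (v.adicCompletion K), ‖θ z‖ ≤ 1 ↔ ‖z‖ ≤ 1) ∧
      (∀ z : CompletedAlgClosure (v.adicCompletion K), ‖θ z‖ < 1 ↔ ‖z‖ < 1) ∧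
      (∀ z : CompletedAlgClosure (v.adicCompletion K), ‖θ z‖ = 1 ↔ ‖z‖ = 1) ∧
      Continuous θ ∧ Continuous θ.symm ∧
      (∀ z : CBall (v.adicCompletion K), ‖θ.toRingHom (z : CompletedAlgClosure (v.adicCompletion K))‖ ≤ 1) ∧
      (∀ a : 𝒪[v.adicCompletion K], (θ.toRingHom.comp ((CBall (v.adicCompletion K)).subtype.comp
          (algebraMap (UnrCoeff (v.adicCompletion K)) (CBall (v.adicCompletion K))))) (intToUnrCoeff (v.adicCompletion K) a) =
        padicIntCast ℂ_[p] ((((padicIntEquivOfDegreeOne K p v he hf : v.adicCompletionIntegers K ≃+* ℤ_[p]) :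
            v.adicCompletionIntegers K →+* ℤ_[p]).comp (integerEquivAdicCompletionIntegers v).toRingHom) a)) := by
  haveI : CharZero (v.adicCompletion K) :=
    charZero_of_injective_algebraMap (algebraMap K (v.adicCompletion K)).injective
  obtain ⟨θ, hι, hφ, ht, hle, hlt, heq, hc, hcs⟩ :=
    CompletedAlgClosure.exists_ringEquiv_padicComplex_of_continuous (F := v.adicCompletion K) p
      (padicEquivOfDegreeOne K p v he hf).toRingHom (continuous_padicEquivOfDegreeOne K p v he hf)
      (valuation_natCast_lt_one_of_degree_one K p v he hf)
  refine ⟨θ, hι, fun a => hφ a, ht, hle, hlt, heq, hc, hcs, fun z => (hle _).mpr z.2, fun a => ?_⟩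
  have hb : (((((padicIntEquivOfDegreeOne K p v he hf : v.adicCompletionIntegers K ≃+* ℤ_[p]) :
        v.adicCompletionIntegers K →+* ℤ_[p]).comp (integerEquivAdicCompletionIntegers v).toRingHom) a : ℤ_[p]) : ℚ_[p]) =
      padicEquivOfDegreeOne K p v he hf (a : v.adicCompletion K) := by
    show ((padicIntEquivOfDegreeOne K p v he hf (integerEquivAdicCompletionIntegers v a) : ℤ_[p]) : ℚ_[p]) = _
    rw [coe_padicIntEquivOfDegreeOne_apply]
    rfl
  rw [RingHom.comp_apply, RingHom.comp_apply, Subring.subtype_apply, coe_algebraMap_intToUnrCoeff, RingEquiv.toRingHom_eq_coe,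
    RingHom.coe_coe, hφ, padicIntCast_apply, hb]
  rfl

end Named

/-! ## §5. `p = 2`, NAMED: the same over `padicEquivOfDegreeOne K 2 v he hf`, `hθ1` / `hΘe` VERBATIM -/

section NamedTwo

variable (K : Type) [Field K] [NumberField K] (v : HeightOneSpectrum (𝓞 K)) [v.asIdeal.LiesOver (ratPlace 2).asIdeal]
  (he : v.asIdeal.ramificationIdx (𝓞 ℚ) = 1) (hf : v.asIdeal.inertiaDeg (𝓞 ℚ) = 1)

/-- ★★ **At `p = 2`: `θ : ℂ_{K_v} ≃+* ℂ_[2]` over `padicEquivOfDegreeOne K 2 v he hf`**, with the algebraic elements, `θ ∘ algebraMap = φ`,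
both unit balls, continuity, and — for `θ.toRingHom` — `hθ1`, `hΘe` (`e₂ := padicIntEquivOfDegreeOne K 2 v he hf`) in the LETTER of
`exists_groupDistribution_twisting_eq_induce_ellipticUnitsLocal(_of_principal)`.
[cite: deShalit1987, I.3.3 (p. 17), II.1.1 (p. 32), II.4.12 (p. 66–69)] -/
theorem exists_ringEquiv_theta_two_padicEquivOfDegreeOne :
    letI : Algebra (v.adicCompletion K) ℚ_[2] := (padicEquivOfDegreeOne K 2 v he hf).toRingHom.toAlgebra
    ∃ θ : CompletedAlgClosure (v.adicCompletion K) ≃+* ℂ_[2],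
      (∀ y : AlgebraicClosure (v.adicCompletion K), θ (algClosureToC (v.adicCompletion K) y) =
        ((absClosureEmbedding (v.adicCompletion K) ℚ_[2] y : PadicAlgCl 2) : ℂ_[2])) ∧
      (∀ a : v.adicCompletion K, θ (algebraMap (v.adicCompletion K) (CompletedAlgClosure (v.adicCompletion K)) a) =
        ((padicEquivOfDegreeOne K 2 v he hf a : ℚ_[2]) : ℂ_[2])) ∧
      (∀ z : CompletedAlgClosure (v.adicCompletion K), ‖θ z‖ ≤ 1 ↔ ‖z‖ ≤ 1) ∧
      (∀ z : CompletedAlgClosure (v.adicCompletion K), ‖θ z‖ < 1 ↔ ‖z‖ < 1) ∧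
      Continuous θ ∧ Continuous θ.symm ∧
      (∀ z : CBall (v.adicCompletion K), ‖θ.toRingHom (z : CompletedAlgClosure (v.adicCompletion K))‖ ≤ 1) ∧
      (∀ a : 𝒪[v.adicCompletion K], (θ.toRingHom.comp ((CBall (v.adicCompletion K)).subtype.comp
          (algebraMap (UnrCoeff (v.adicCompletion K)) (CBall (v.adicCompletion K))))) (intToUnrCoeff (v.adicCompletion K) a) =
        padicIntCast ℂ_[2] ((((padicIntEquivOfDegreeOne K 2 v he hf : v.adicCompletionIntegers K ≃+* ℤ_[2]) :
            v.adicCompletionIntegers K →+* ℤ_[2]).comp (integerEquivAdicCompletionIntegers v).toRingHom) a)) := by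
  obtain ⟨θ, hι, hφ, -, hle, hlt, -, hc, hcs, hθ1, hΘe⟩ := exists_ringEquiv_theta_padicEquivOfDegreeOne K 2 v he hf
  exact ⟨θ, hι, hφ, hle, hlt, hc, hcs, hθ1, hΘe⟩

end NamedTwo

/-! ## §6. UNIQUENESS: continuous ring maps out of `ℚ_[p]`, hence out of `K_v` at a place of degree one, are determined —
every continuous `g : K_v →+* R` into a Hausdorff topological ring is `f ∘ padicEquivOfDegreeOne` for ANY continuous
`f : ℚ_[p] →+* R` (the «e₁ = (ℚ₂ ↪ ℚ̄₂) ∘ (K_v ≃ ℚ₂) by uniqueness» square of the interpolation junction, cf2c-w4 g8's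
AVATAR-ON-RAY-KERNEL memo §2) -/

section Unique

variable (K : Type) [Field K] [NumberField K] (p : ℕ) [hp : Fact p.Prime] (v : HeightOneSpectrum (𝓞 K))
  [v.asIdeal.LiesOver (ratPlace p).asIdeal]
  (he : v.asIdeal.ramificationIdx (𝓞 ℚ) = 1) (hf : v.asIdeal.inertiaDeg (𝓞 ℚ) = 1)

/-- **Continuous ring maps `ℚ_[p] → R` into a Hausdorff topological ring coincide** (they agree on the dense subring `ℚ`:
Mathlib `RingHom.ext_rat`, `Padic.denseRange_ratCast`). [cite: NeukirchANT1999, Ch. II (2.1)] -/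
theorem Padic.ringHom_eq_of_continuous {R : Type*} [Semiring R] [TopologicalSpace R] [T2Space R] {f g : ℚ_[p] →+* R}
    (hfc : Continuous f) (hgc : Continuous g) : f = g := by
  have heq : (f : ℚ_[p] → R) ∘ ((↑) : ℚ → ℚ_[p]) = (g : ℚ_[p] → R) ∘ ((↑) : ℚ → ℚ_[p]) := by
    have h := RingHom.ext_rat (f.comp (Rat.castHom ℚ_[p])) (g.comp (Rat.castHom ℚ_[p]))
    funext r
    exact RingHom.congr_fun h r
  exact RingHom.ext fun x => congrFun ((Padic.denseRange_ratCast (p := p)).equalizer hfc hgc heq) x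

/-- ★ **At a place of degree one, a continuous ring map `g : K_v → R` into a Hausdorff topological ring is `f ∘ (K_v ≅ ℚ_p)` for
ANY continuous ring map `f : ℚ_[p] → R`** (`g ∘ (K_v ≅ ℚ_p)⁻¹` and `f` are continuous ring maps out of `ℚ_[p]`). In particular two
continuous `p`-adic embeddings of `K_v` with the same continuous restriction type agree — the uniqueness used at the interpolation
junction (`e₁ = (ℚ_p ⊆ ℚ̄_p) ∘ padicEquivOfDegreeOne`). [cite: FrohlichTaylor1990, Ch. III §1 (1.14)(a)] [cite: NeukirchANT1999, Ch. II (2.1)] -/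
theorem ringHom_eq_comp_padicEquivOfDegreeOne_of_continuous {R : Type*} [Semiring R] [TopologicalSpace R] [T2Space R]
    (g : v.adicCompletion K →+* R) (hgc : Continuous g) (f : ℚ_[p] →+* R) (hfc : Continuous f) :
    g = f.comp (padicEquivOfDegreeOne K p v he hf).toRingHom := by
  have h1 : g.comp (padicEquivOfDegreeOne K p v he hf).symm.toRingHom = f :=
    Padic.ringHom_eq_of_continuous p (hgc.comp (continuous_padicEquivOfDegreeOne_symm K p v he hf)) hfc
  rw [← h1]
  ext x
  simp

/-- Pointwise form: `g x = f (padicEquivOfDegreeOne K p v he hf x)`. [cite: FrohlichTaylor1990, Ch. III §1 (1.14)(a)] -/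
theorem ringHom_apply_eq_of_continuous {R : Type*} [Semiring R] [TopologicalSpace R] [T2Space R]
    (g : v.adicCompletion K →+* R) (hgc : Continuous g) (f : ℚ_[p] →+* R) (hfc : Continuous f) (x : v.adicCompletion K) :
    g x = f (padicEquivOfDegreeOne K p v he hf x) := by
  rw [ringHom_eq_comp_padicEquivOfDegreeOne_of_continuous K p v he hf g hgc f hfc]
  rfl

include p he hf in
/-- **Two continuous ring maps `K_v → R` into a Hausdorff topological ring AGREE** at a place `v` of degree one (`g₁ ∘ (K_v ≅ ℚ_p)⁻¹`
and `g₂ ∘ (K_v ≅ ℚ_p)⁻¹` are continuous ring maps out of `ℚ_[p]`) — e.g. the continuous `p`-adic embeddings `K_v → ℚ̄_p`, `K_v → ℂ_p`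
are unique. [cite: FrohlichTaylor1990, Ch. III §1 (1.14)(a)] [cite: NeukirchANT1999, Ch. II (2.1)] -/
theorem ringHom_eq_ringHom_of_continuous {R : Type*} [Semiring R] [TopologicalSpace R] [T2Space R]
    (g₁ g₂ : v.adicCompletion K →+* R) (h₁ : Continuous g₁) (h₂ : Continuous g₂) : g₁ = g₂ := by
  have e1 := ringHom_eq_comp_padicEquivOfDegreeOne_of_continuous K p v he hf g₁ h₁
    (g₂.comp (padicEquivOfDegreeOne K p v he hf).symm.toRingHom)
    (h₂.comp (continuous_padicEquivOfDegreeOne_symm K p v he hf))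
  rw [e1]
  ext x
  simp

end Unique

/-! ## §7. The MOMENTS files' extra `θ`-hypotheses `hθc`, `hθζ` (automatic for bijective `θ`); the package `hθc ∧ hθ1 ∧ hθζ ∧ hΘe` -/

section Moments

variable (K : Type) [Field K] [NumberField K] (p : ℕ) [hp : Fact p.Prime] (v : HeightOneSpectrum (𝓞 K))
  [v.asIdeal.LiesOver (ratPlace p).asIdeal]
  (he : v.asIdeal.ramificationIdx (𝓞 ℚ) = 1) (hf : v.asIdeal.inertiaDeg (𝓞 ℚ) = 1)

omit hp in
/-- `hθζ` for a ring ISOMORPHISM: a `p`-power root of unity `ζ'` of the target is `θ (θ⁻¹ ζ')`. [cite: deShalit1987, I.3.3 (7) (p. 17)] -/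
theorem exists_pow_pow_eq_one_map_eq_of_ringEquiv {A B : Type*} [Semiring A] [Semiring B] (θ : A ≃+* B) (ζ' : B)
    (hζ' : ∃ n : ℕ, ζ' ^ p ^ n = 1) : ∃ ζ : A, (∃ n : ℕ, ζ ^ p ^ n = 1) ∧ θ ζ = ζ' := by
  obtain ⟨n, hn⟩ := hζ'
  exact ⟨θ.symm ζ', ⟨n, by rw [← map_pow, hn, map_one]⟩, θ.apply_symm_apply ζ'⟩

/-- ★★ **The `θ`-package of the moments files at a place of degree one above `p`: `hθc ∧ hθ1 ∧ hθζ ∧ hΘe`** (`e₂ :=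
padicIntEquivOfDegreeOne K p v he hf`), with `θ ∘ algebraMap K_v = coe ∘ padicEquivOfDegreeOne K p v he hf` and bijectivity — read off
`exists_ringEquiv_theta_padicEquivOfDegreeOne`. [cite: deShalit1987, I.3.3 (p. 17), II.1.1 (p. 32), II.4.7 (p. 60), II.4.12 (p. 66–69)] -/
theorem exists_theta_moments_padicEquivOfDegreeOne :
    ∃ θ : CompletedAlgClosure (v.adicCompletion K) →+* ℂ_[p],
      Continuous θ ∧ Function.Bijective θ ∧
      (∀ z : CBall (v.adicCompletion K), ‖θ (z : CompletedAlgClosure (v.adicCompletion K))‖ ≤ 1) ∧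
      (∀ ζ' : ℂ_[p], (∃ n : ℕ, ζ' ^ p ^ n = 1) →
        ∃ ζ : CompletedAlgClosure (v.adicCompletion K), (∃ n : ℕ, ζ ^ p ^ n = 1) ∧ θ ζ = ζ') ∧
      (∀ a : 𝒪[v.adicCompletion K], (θ.comp ((CBall (v.adicCompletion K)).subtype.comp
          (algebraMap (UnrCoeff (v.adicCompletion K)) (CBall (v.adicCompletion K))))) (intToUnrCoeff (v.adicCompletion K) a) =
        padicIntCast ℂ_[p] ((((padicIntEquivOfDegreeOne K p v he hf : v.adicCompletionIntegers K ≃+* ℤ_[p]) :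
            v.adicCompletionIntegers K →+* ℤ_[p]).comp (integerEquivAdicCompletionIntegers v).toRingHom) a)) ∧
      (∀ a : v.adicCompletion K, θ (algebraMap (v.adicCompletion K) (CompletedAlgClosure (v.adicCompletion K)) a) =
        ((padicEquivOfDegreeOne K p v he hf a : ℚ_[p]) : ℂ_[p])) ∧
      (∀ z : CompletedAlgClosure (v.adicCompletion K), ‖z‖ < 1 → ‖θ z‖ < 1) := by
  obtain ⟨θ, -, hφ, -, -, hlt, -, hc, -, hθ1, hΘe⟩ := exists_ringEquiv_theta_padicEquivOfDegreeOne K p v he hf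
  exact ⟨θ.toRingHom, hc, θ.bijective, hθ1, fun ζ' hζ' => exists_pow_pow_eq_one_map_eq_of_ringEquiv p θ ζ' hζ', hΘe,
    fun a => hφ a, fun z hz => (hlt z).mpr hz⟩

/-- ★★ **At `p = 2`, VERBATIM the `θ`-hypotheses `hθc`, `hθ1`, `hθζ`, `hΘe` (`e₂ := padicIntEquivOfDegreeOne K 2 v he hf`) of
`integral_character_pow_succ_ellipticUnitsLocal` / `exists_groupDistribution_twisting_eq_induce_ellipticUnitsLocal(_of_principal)`**, with
`θ ∘ algebraMap K_v = coe ∘ padicEquivOfDegreeOne K 2 v he hf`. [cite: deShalit1987, I.3.3 (p. 17), II.4.7 (p. 60), II.4.12 (p. 66–69)] -/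
theorem exists_theta_two_moments_padicEquivOfDegreeOne (K : Type) [Field K] [NumberField K] (v : HeightOneSpectrum (𝓞 K))
    [v.asIdeal.LiesOver (ratPlace 2).asIdeal] (he : v.asIdeal.ramificationIdx (𝓞 ℚ) = 1) (hf : v.asIdeal.inertiaDeg (𝓞 ℚ) = 1) :
    ∃ θ : CompletedAlgClosure (v.adicCompletion K) →+* ℂ_[2],
      Continuous θ ∧ Function.Bijective θ ∧
      (∀ z : CBall (v.adicCompletion K), ‖θ (z : CompletedAlgClosure (v.adicCompletion K))‖ ≤ 1) ∧
      (∀ ζ' : ℂ_[2], (∃ n : ℕ, ζ' ^ 2 ^ n = 1) →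
        ∃ ζ : CompletedAlgClosure (v.adicCompletion K), (∃ n : ℕ, ζ ^ 2 ^ n = 1) ∧ θ ζ = ζ') ∧
      (∀ a : 𝒪[v.adicCompletion K], (θ.comp ((CBall (v.adicCompletion K)).subtype.comp
          (algebraMap (UnrCoeff (v.adicCompletion K)) (CBall (v.adicCompletion K))))) (intToUnrCoeff (v.adicCompletion K) a) =
        padicIntCast ℂ_[2] ((((padicIntEquivOfDegreeOne K 2 v he hf : v.adicCompletionIntegers K ≃+* ℤ_[2]) :
            v.adicCompletionIntegers K →+* ℤ_[2]).comp (integerEquivAdicCompletionIntegers v).toRingHom) a)) ∧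
      (∀ a : v.adicCompletion K, θ (algebraMap (v.adicCompletion K) (CompletedAlgClosure (v.adicCompletion K)) a) =
        ((padicEquivOfDegreeOne K 2 v he hf a : ℚ_[2]) : ℂ_[2])) ∧
      (∀ z : CompletedAlgClosure (v.adicCompletion K), ‖z‖ < 1 → ‖θ z‖ < 1) :=
  exists_theta_moments_padicEquivOfDegreeOne K 2 v he hf

end Moments

end Summit.BirchSwinnertonDyer.BirchSwinnertonDyer.Theorems.PrintCf2.EllipticUnitsLocal.Seam

end
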